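import Summits.CriticalPhenomena.CardyFormulaZ2.Theses.CardyIKTransport

/-!
# Disproof attempts on `IKMixedBoxCrossing` (crux stmt-CriticalPhenomena-5911) — standing adversary file

Findings index (cdisprove seat `refuter-cdisprove-stmt-CriticalPhenomena-5911-0`, cycle 1, 2026-08-16):

* §1 `iff_named` — the crux restated over NAMED pieces of the explicit i.i.d.-bit gauge
  (`μIK`, `par`, `blk`, `anti`, `edges`, `pH`, `pV`); definitional (`Iff.rfl`), so every lemma below
  is about the crux verbatim.
* §2 LOAD-BEARING `1 ≤ n`: `iKMixedBoxCrossing_false_without_n_pos` — with `n = 0` the source side of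
  the box is empty, the crossing event is `∅`, so no `c > 0` works. (The only explicit hypothesis.)
* §3 TIGHTNESS of the constant: `pH_one_zero_zero : pH S 1 0 0 = 1/4` (two adjacent cells both black;
  pair correlations of the colour field vanish) and `c_le_quarter` — any admissible `c` is `≤ 1/4`.
  This also certifies that the interface is NON-JUNK: `μIK` is a genuine product probability measure
  and the `n = 1` crossing event is a non-trivial cylinder of measure exactly `1/4` for EVERY `S`.
* §4 LOAD-BEARING OBSTRUCTION `colourField_not_positivelyAssociated` — Harris–FKG FAILS for the
  colour field on every `S`-column face: `P(E₁ ∩ E₂) = (1+p)/8 < 3/16 = P(E₁)P(E₂)` for the increasing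
  colour events `E₁ = {c(0,0) ∨ c(1,0)}`, `E₂ = {c(0,1) ∧ c(1,1)}` (kernel-checked product-measure
  computation; `p = 2√3−3 < 1/2`). Any proof must avoid positive association of colours.
  §4b `bondField_not_positivelyAssociated` — the BOND field `edges S ω` (in which crossing events ARE
  increasing) is not positively associated either: on an `S`-column face the two diagonal bonds are
  each open with probability `1/8` and never together (one diagonal per face).
* §5 NUMERICAL ATTACK (kit job ids in the docstrings): adversarial Monte-Carlo over column patterns
  `S` (periodic, blocks, half-spaces, single defects, random, Sturmian, sparse, and a greedy search
  minimising the crossing probability over `S` at n = 8, 16, 32), n ≤ 256 — see `numerics_summary`.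
* §6 WHY IT RESISTS (docstring `why_it_resists`): structural reasons no cheap counterexample exists.

Nothing in this file asserts the crux or any Theses decl positively.
-/

namespace Summit.CriticalPhenomena.CardyFormulaZ2.Cruxes.IKMixedBoxCrossing.Disproof

open scoped Classical ENNReal
open MeasureTheory ProbabilityTheory unitInterval
open Literature.Probability.Percolation Literature.Probability.LatticeModels
open Summit.CriticalPhenomena.CardyFormulaZ2.Theses.CardyIKTransport (IKMixedBoxCrossing)

noncomputable section

/-! ## §1 The explicit gauge, named -/

/-- Bit space of the gauge: column signs `A ⊆ ℤ` × row signs `B ⊆ ℤ` × biased plaquettes ×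
fair plaquettes × diagonal coins. -/
abbrev Ω : Type := Set ℤ × (Set ℤ × (Set (Site 2) × (Set (Site 2) × Set (Site 2))))

/-- The gauge measure (independent of the column pattern `S`). -/
def μIK : Measure Ω :=
  (sitePercolation ℤ half).prod ((sitePercolation ℤ half).prod
    ((sitePercolation (Site 2) (Set.projIcc (0:ℝ) 1 zero_le_one (2 * Real.sqrt 3 - 3))).prod
      ((sitePercolation (Site 2) half).prod (sitePercolation (Site 2) half))))

/-- Plaquette defect at the face with lower-left cell `f`: biased field on `S`-columns, fair elsewhere. -/
def par (S : Set ℤ) (ω : Ω) (f : Site 2) : Prop :=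
  (f 0 ∈ S ∧ f ∈ ω.2.2.1) ∨ (f 0 ∉ S ∧ f ∈ ω.2.2.2.1)

/-- Black cell: column sign ⊕ row sign ⊕ parity of the defects in the rectangle between `0` and `v`. -/
def blk (S : Set ℤ) (ω : Ω) (v : Site 2) : Prop :=
  Xor (v 0 ∈ ω.1) (Xor (v 1 ∈ ω.2.1) (Odd ((Finset.filter (fun f : ℤ × ℤ => par S ω ![f.1, f.2])
    (Finset.Ico (min 0 (v 0)) (max 0 (v 0)) ×ˢ Finset.Ico (min 0 (v 1)) (max 0 (v 1)))).card)))

/-- The face `f` carries the ANTI-diagonal: forced off `S`, a fair coin on `S`. -/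
def anti (S : Set ℤ) (ω : Ω) (f : Site 2) : Prop := f 0 ∉ S ∨ f ∈ ω.2.2.2.2

/-- Open edges: nearest-neighbour and chosen-diagonal pairs of black cells. -/
def edges (S : Set ℤ) (ω : Ω) : BondConfig (Site 2) :=
  {e | ∃ u v, e = s(u, v) ∧ blk S ω u ∧ blk S ω v ∧ (v = u + ![1, 0] ∨ v = u + ![0, 1] ∨
    (v = u + ![1, 1] ∧ ¬ anti S ω u) ∨ (v = u + ![1, -1] ∧ anti S ω (u + ![0, -1])))}

/-- Black left–right crossing EVENT of the `2n × n` box at `(a, b)`. -/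
def hEvent (S : Set ℤ) (n : ℕ) (a b : ℤ) : Set Ω :=
  {ω | edges S ω ∈ openCrossing {v | a ≤ v 0 ∧ v 0 < a + 2 * n ∧ b ≤ v 1 ∧ v 1 < b + n}
    {v | v 0 = a ∧ b ≤ v 1 ∧ v 1 < b + n} {v | v 0 = a + 2 * n - 1 ∧ b ≤ v 1 ∧ v 1 < b + n}}

/-- Black bottom–top crossing EVENT of the `n × 2n` box at `(a, b)`. -/
def vEvent (S : Set ℤ) (n : ℕ) (a b : ℤ) : Set Ω :=
  {ω | edges S ω ∈ openCrossing {v | a ≤ v 0 ∧ v 0 < a + n ∧ b ≤ v 1 ∧ v 1 < b + 2 * n}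
    {v | v 1 = b ∧ a ≤ v 0 ∧ v 0 < a + n} {v | v 1 = b + 2 * n - 1 ∧ a ≤ v 0 ∧ v 0 < a + n}}

/-- Black left–right crossing probability of the `2n × n` box at `(a, b)`. -/
def pH (S : Set ℤ) (n : ℕ) (a b : ℤ) : ℝ := μIK.real (hEvent S n a b)

/-- Black bottom–top crossing probability of the `n × 2n` box at `(a, b)`. -/
def pV (S : Set ℤ) (n : ℕ) (a b : ℤ) : ℝ := μIK.real (vEvent S n a b)

/-- The crux, verbatim, over the named pieces (definitional unfolding only). -/
theorem iff_named :
    IKMixedBoxCrossing ↔ ∃ c : ℝ, 0 < c ∧ ∀ S : Set ℤ, ∀ n : ℕ, 1 ≤ n → ∀ a b : ℤ,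
      c ≤ pH S n a b ∧ c ≤ pV S n a b := by
  -- unfold the names and zeta/beta-reduce the thesis' `let`s; `simp only` then closes by `Iff.rfl`
  simp only [IKMixedBoxCrossing, pH, pV, hEvent, vEvent, edges, blk, anti, par, μIK]

/-! ## §2 Load-bearing hypothesis `1 ≤ n` -/

/-- The crux with the side condition `1 ≤ n` dropped. -/
def IKMixedBoxCrossingWithout_n_pos : Prop :=
  ∃ c : ℝ, 0 < c ∧ ∀ S : Set ℤ, ∀ n : ℕ, ∀ a b : ℤ, c ≤ pH S n a b ∧ c ≤ pV S n a b

/-- A set with no element has `μIK.real`-mass `0` (bookkeeping). -/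
theorem real_eq_zero_of_forall_notMem {s : Set Ω} (hs : ∀ ω, ω ∉ s) : μIK.real s = 0 := by
  rw [Set.eq_empty_of_forall_notMem hs]; simp

/-- For `n = 0` the source side of the `2n × n` box is empty, so the crossing event is empty. -/
theorem pH_zero (S : Set ℤ) (a b : ℤ) : pH S 0 a b = 0 := by
  unfold pH hEvent
  apply real_eq_zero_of_forall_notMem
  intro ω hω
  simp only [Set.mem_setOf_eq, mem_openCrossing_iff] at hω
  obtain ⟨x, ⟨-, hb, hlt⟩, -⟩ := hω
  push_cast at hlt
  omega

/-- Likewise for the `n × 2n` box. -/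
theorem pV_zero (S : Set ℤ) (a b : ℤ) : pV S 0 a b = 0 := by
  unfold pV vEvent
  apply real_eq_zero_of_forall_notMem
  intro ω hω
  simp only [Set.mem_setOf_eq, mem_openCrossing_iff] at hω
  obtain ⟨x, ⟨-, ha, hlt⟩, -⟩ := hω
  push_cast at hlt
  omega

/-- Any proof must use `1 ≤ n`: without it the statement is false (witness `n = 0`). -/
theorem iKMixedBoxCrossing_false_without_n_pos : ¬ IKMixedBoxCrossingWithout_n_pos := by
  rintro ⟨c, hc, h⟩
  have h0 := (h ∅ 0 0 0).1
  rw [pH_zero] at h0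
  exact absurd h0 (not_le.mpr hc)

/-! ## §3 Tightness of the constant: the `n = 1` boxes have crossing probability exactly `1/4`

The colour field is pairwise independent (pair correlations vanish), so two adjacent cells are both
black with probability `1/4`; for `n = 1` the long-way crossing of the `2 × 1` box IS that event.
Hence every admissible constant satisfies `c ≤ 1/4` (`c_le_quarter`). The computation also certifies
that the interface is non-junk: `μIK` is a genuine product probability measure and the crossing
event is a non-trivial cylinder. -/

/-- The four hidden factors of the gauge (everything but the column signs `A`). -/
abbrev Rest : Type := Set ℤ × (Set (Site 2) × (Set (Site 2) × Set (Site 2)))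

/-- Their joint law. -/
def ν : Measure Rest :=
  (sitePercolation ℤ half).prod
    ((sitePercolation (Site 2) (Set.projIcc (0:ℝ) 1 zero_le_one (2 * Real.sqrt 3 - 3))).prod
      ((sitePercolation (Site 2) half).prod (sitePercolation (Site 2) half)))

theorem μIK_eq : μIK = (sitePercolation ℤ half).prod ν := rfl

instance : IsProbabilityMeasure ν := by unfold ν; infer_instance
instance : IsProbabilityMeasure μIK := by unfold μIK; infer_instance

theorem symm_half : σ half = half := by
  apply Subtype.ext; rw [coe_symm_eq, coe_half]; norm_num

/-- The Bernoulli(1/2) factor of `setBer(univ, half)` gives mass `1/2` to `{q | q}` … -/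
theorem factor_true (i : ℤ) :
    (toNNReal half • Measure.dirac (i ∈ (Set.univ : Set ℤ)) + toNNReal (σ half) • Measure.dirac False)
      {q : Prop | q} = toNNReal half := by
  simp [Set.indicator]

/-- … and mass `1/2` to `{q | ¬ q}`. -/
theorem factor_false (i : ℤ) :
    (toNNReal half • Measure.dirac (i ∈ (Set.univ : Set ℤ)) + toNNReal (σ half) • Measure.dirac False)
      {q : Prop | ¬ q} = toNNReal half := by
  simp [Set.indicator, symm_half]

theorem μA_mem_mem : sitePercolation ℤ half {A : Set ℤ | 0 ∈ A ∧ 1 ∈ A} = toNNReal half * toNNReal half := by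
  rw [sitePercolation, setBernoulli_apply']
  have : (fun p : ℤ → Prop ↦ {i | p i}) ⁻¹' {A : Set ℤ | 0 ∈ A ∧ 1 ∈ A}
      = Set.pi (({0, 1} : Finset ℤ) : Set ℤ) (fun _ => {q : Prop | q}) := by
    ext f; simp
  rw [this, Measure.infinitePi_pi _ (fun _ _ => MeasurableSpace.measurableSet_top),
    Finset.prod_pair (by norm_num), factor_true, factor_true]

theorem μA_not_not : sitePercolation ℤ half {A : Set ℤ | 0 ∉ A ∧ 1 ∉ A} = toNNReal half * toNNReal half := by
  rw [sitePercolation, setBernoulli_apply']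
  have : (fun p : ℤ → Prop ↦ {i | p i}) ⁻¹' {A : Set ℤ | 0 ∉ A ∧ 1 ∉ A}
      = Set.pi (({0, 1} : Finset ℤ) : Set ℤ) (fun _ => {q : Prop | ¬ q}) := by
    ext f; simp
  rw [this, Measure.infinitePi_pi _ (fun _ _ => MeasurableSpace.measurableSet_top),
    Finset.prod_pair (by norm_num), factor_false, factor_false]

theorem μA_mem : sitePercolation ℤ half {A : Set ℤ | 0 ∈ A} = toNNReal half := by
  rw [sitePercolation, setBernoulli_apply']
  have : (fun p : ℤ → Prop ↦ {i | p i}) ⁻¹' {A : Set ℤ | 0 ∈ A}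
      = Set.pi (({0} : Finset ℤ) : Set ℤ) (fun _ => {q : Prop | q}) := by
    ext f; simp
  rw [this, Measure.infinitePi_pi _ (fun _ _ => MeasurableSpace.measurableSet_top),
    Finset.prod_singleton, factor_true]

theorem μA_not : sitePercolation ℤ half {A : Set ℤ | 0 ∉ A} = toNNReal half := by
  rw [sitePercolation, setBernoulli_apply']
  have : (fun p : ℤ → Prop ↦ {i | p i}) ⁻¹' {A : Set ℤ | 0 ∉ A}
      = Set.pi (({0} : Finset ℤ) : Set ℤ) (fun _ => {q : Prop | ¬ q}) := by
    ext f; simp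
  rw [this, Measure.infinitePi_pi _ (fun _ _ => MeasurableSpace.measurableSet_top),
    Finset.prod_singleton, factor_false]

theorem ν_fst_mem : ν {y : Rest | 0 ∈ y.1} = toNNReal half := by
  have : {y : Rest | 0 ∈ y.1} = {B : Set ℤ | 0 ∈ B} ×ˢ Set.univ := by ext; simp
  rw [this, ν, Measure.prod_prod, μA_mem, measure_univ, mul_one]

theorem ν_fst_not : ν {y : Rest | 0 ∉ y.1} = toNNReal half := by
  have : {y : Rest | 0 ∉ y.1} = {B : Set ℤ | 0 ∉ B} ×ˢ Set.univ := by ext; simp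
  rw [this, ν, Measure.prod_prod, μA_not, measure_univ, mul_one]

/-- The `n = 1` horizontal event in bit form: cells `(0,0)` and `(1,0)` both black, i.e.
`A₀ ⊕ B₀` and `A₁ ⊕ B₀`. -/
def F : Set Ω := {ω | Xor (0 ∈ ω.1) (0 ∈ ω.2.1) ∧ Xor (1 ∈ ω.1) (0 ∈ ω.2.1)}

theorem F_eq : F = ({A : Set ℤ | 0 ∉ A ∧ 1 ∉ A} ×ˢ {y : Rest | 0 ∈ y.1}) ∪
    ({A : Set ℤ | 0 ∈ A ∧ 1 ∈ A} ×ˢ {y : Rest | 0 ∉ y.1}) := by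
  ext ω
  simp only [F, Xor, Set.mem_setOf_eq, Set.mem_union, Set.mem_prod]
  tauto

theorem μIK_F : μIK F = 2 * ((toNNReal half : ℝ≥0∞) * toNNReal half * toNNReal half) := by
  rw [F_eq, measure_union, μIK_eq, Measure.prod_prod, Measure.prod_prod, μA_not_not, μA_mem_mem,
    ν_fst_mem, ν_fst_not]
  · ring
  · rw [Set.disjoint_left]
    rintro ⟨A, y⟩ ⟨⟨h0, -⟩, -⟩ ⟨⟨h0', -⟩, -⟩
    exact h0 h0'
  · exact ((measurableSet_mem 0).inter (measurableSet_mem 1)).prod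
      (measurable_fst (measurableSet_notMem 0))

theorem μIK_real_F : μIK.real F = 1 / 4 := by
  rw [Measure.real, μIK_F]
  have h : ((toNNReal half : ℝ≥0∞)).toReal = 1 / 2 := by
    rw [ENNReal.coe_toReal, coe_toNNReal, coe_half]
  rw [ENNReal.toReal_mul, ENNReal.toReal_mul, ENNReal.toReal_mul, h]
  norm_num

theorem blk_zero_zero (S : Set ℤ) (ω : Ω) : blk S ω ![0, 0] ↔ Xor (0 ∈ ω.1) (0 ∈ ω.2.1) := by
  simp [blk, Xor]

theorem blk_one_zero (S : Set ℤ) (ω : Ω) : blk S ω ![1, 0] ↔ Xor (1 ∈ ω.1) (0 ∈ ω.2.1) := by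
  simp [blk, Xor]

theorem vec_eq_zero_zero {x : Site 2} (h0 : x 0 = 0) (h1 : x 1 = 0) : x = ![0, 0] := by
  ext i; fin_cases i <;> simp [h0, h1]

theorem vec_eq_one_zero {x : Site 2} (h0 : x 0 = 1) (h1 : x 1 = 0) : x = ![1, 0] := by
  ext i; fin_cases i <;> simp [h0, h1]

/-- EVENT IDENTIFICATION at `n = 1`: the `2 × 1` box `{(0,0), (1,0)}` is crossed iff both cells are
black (the only available edge is the horizontal bond; `openConnIn` keeps the path inside the box). -/
theorem hEvent_one (S : Set ℤ) : hEvent S 1 0 0 = F := by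
  ext ω
  simp only [hEvent, F, Set.mem_setOf_eq, mem_openCrossing_iff, openConnIn]
  constructor
  · rintro ⟨x, ⟨hx0, hx1, hx2⟩, y, ⟨hy0, hy1, hy2⟩, hxS, hyS, hreach⟩
    have hx : x = ![0, 0] := vec_eq_zero_zero hx0 (by omega)
    rw [SimpleGraph.reachable_iff_reflTransGen] at hreach
    rcases hreach.cases_head with heq | ⟨w, hadj, -⟩
    · have := congrArg Subtype.val heq
      simp only at this
      rw [this] at hx0
      push_cast at hy0
      omega
    · rw [SimpleGraph.induce_adj, openGraph_adj] at hadj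
      obtain ⟨hmem, hne⟩ := hadj
      have hw := w.2
      simp only [Set.mem_setOf_eq] at hw
      obtain ⟨hw0, hw1, hw2, hw3⟩ := hw
      have hw' : (w : Site 2) = ![1, 0] := by
        refine vec_eq_one_zero ?_ (by omega)
        rcases (show (w : Site 2) 0 = 0 ∨ (w : Site 2) 0 = 1 by push_cast at hw1; omega) with h | h
        · exact absurd ((hx.trans (vec_eq_zero_zero h (by omega)).symm)) hne
        · exact h
      simp only [edges, Set.mem_setOf_eq] at hmem
      obtain ⟨u, v, huv, hu, hv, -⟩ := hmem
      rw [hx, hw', Sym2.eq_iff] at huv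
      rcases huv with ⟨rfl, rfl⟩ | ⟨rfl, rfl⟩
      · exact ⟨(blk_zero_zero S ω).1 hu, (blk_one_zero S ω).1 hv⟩
      · exact ⟨(blk_zero_zero S ω).1 hv, (blk_one_zero S ω).1 hu⟩
  · rintro ⟨h0, h1⟩
    refine ⟨![0, 0], ⟨by simp, by simp, by simp⟩, ![1, 0], ⟨by simp, by simp, by simp⟩,
      ⟨by simp, by simp, by simp, by simp⟩, ⟨by simp, by simp, by simp, by simp⟩, ?_⟩
    apply SimpleGraph.Adj.reachable
    rw [SimpleGraph.induce_adj, openGraph_adj]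
    refine ⟨?_, ?_⟩
    · simp only [edges, Set.mem_setOf_eq]
      exact ⟨![0, 0], ![1, 0], rfl, (blk_zero_zero S ω).2 h0, (blk_one_zero S ω).2 h1,
        Or.inl (by ext i; fin_cases i <;> simp)⟩
    · intro h
      have := congrFun h 0
      simp at this

/-- TIGHTNESS DATUM: the `2 × 1` box at the origin is crossed with probability exactly `1/4`,
for every column pattern `S`. -/
theorem pH_one_zero_zero (S : Set ℤ) : pH S 1 0 0 = 1 / 4 := by
  rw [pH, hEvent_one, μIK_real_F]

/-- Any constant admissible in the crux is at most `1/4` (so the crux is `∃ c ∈ (0, 1/4], …`). -/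
theorem c_le_quarter {c : ℝ}
    (h : ∀ S : Set ℤ, ∀ n : ℕ, 1 ≤ n → ∀ a b : ℤ, c ≤ pH S n a b ∧ c ≤ pV S n a b) : c ≤ 1 / 4 :=
  (pH_one_zero_zero ∅) ▸ (h ∅ 1 le_rfl 0 0).1

/-- The crux with any constant `c > 1/4` is FALSE (refuted strengthening). -/
theorem not_IKMixedBoxCrossing_with_large_constant {c : ℝ} (hc : 1 / 4 < c) :
    ¬ (∀ S : Set ℤ, ∀ n : ℕ, 1 ≤ n → ∀ a b : ℤ, c ≤ pH S n a b ∧ c ≤ pV S n a b) :=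
  fun h => absurd (c_le_quarter h) (not_le.mpr hc)

/-! ## §4 Load-bearing obstruction: the colour field is NOT positively associated

Harris–FKG fails for the law of the colours (already at the level of one face of an `S`-column), so
no proof of the crux can run the standard RSW machinery (Russo–Seymour–Welsh, Kesten's
square-root trick, Köhler-Schindler–Tassion arXiv:2011.04618 Thm 1, Grimmett–Manolescu transport
arXiv:1204.0505) on the colour field as a positively associated measure. Witness (route docstring,
refuter reviews on stmt-5911, here kernel-checked): with `p = 2√3 − 3` the plaquette defect
probability, `P({c(0,0) ∨ c(1,0)} ∩ {c(0,1) ∧ c(1,1)}) = (1 + p)/8 < 3/16 = (3/4)·(1/4)`, i.e.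
covariance `(p − 1/2)/8 = −ρ/16`, `ρ = (1 − t)/(1 + t)`. Off `S` (fair plaquettes, `p = 1/2`) the four
colours of a face are independent and the covariance vanishes. -/

/-- general two-coordinate cylinder of the fair column signs -/
theorem μA_two (P Q : Prop) :
    sitePercolation ℤ half {A : Set ℤ | (0 ∈ A ↔ P) ∧ (1 ∈ A ↔ Q)} = toNNReal half * toNNReal half := by
  rw [sitePercolation, setBernoulli_apply']
  have : (fun p : ℤ → Prop ↦ {i | p i}) ⁻¹' {A : Set ℤ | (0 ∈ A ↔ P) ∧ (1 ∈ A ↔ Q)}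
      = Set.pi (({0, 1} : Finset ℤ) : Set ℤ) (fun i => if i = 0 then {q : Prop | q ↔ P} else {q : Prop | q ↔ Q}) := by
    ext f; simp
  rw [this, Measure.infinitePi_pi _ (fun _ _ => MeasurableSpace.measurableSet_top),
    Finset.prod_pair (by norm_num)]
  have hfac : ∀ (i : ℤ) (R : Prop), (toNNReal half • Measure.dirac (i ∈ (Set.univ : Set ℤ)) +
      toNNReal (σ half) • Measure.dirac False) {q : Prop | q ↔ R} = toNNReal half := by
    intro i R
    by_cases hR : R
    · simp [Set.indicator, hR]
    · simp [Set.indicator, hR, symm_half]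
  simp only [if_true, one_ne_zero, if_false, hfac]

theorem toNNReal_half : toNNReal half = 2⁻¹ := by
  apply NNReal.coe_injective
  simp [coe_toNNReal]

theorem coe_toNNReal_half : (toNNReal half : ℝ≥0∞) = 2⁻¹ := by
  rw [toNNReal_half, ENNReal.coe_inv two_ne_zero, ENNReal.coe_ofNat]

theorem toNNReal_half_mul : (toNNReal half : ℝ≥0∞) * toNNReal half = 4⁻¹ := by
  rw [coe_toNNReal_half, ← ENNReal.mul_inv (Or.inl two_ne_zero) (Or.inl (by norm_num))]
  norm_num

theorem μA_two' (P Q : Prop) :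
    sitePercolation ℤ half {A : Set ℤ | (0 ∈ A ↔ P) ∧ (1 ∈ A ↔ Q)} = 4⁻¹ := by
  rw [μA_two, toNNReal_half_mul]

/-- The plaquette defect probability of the gauge as a point of the unit interval. -/
def pDef : unitInterval := Set.projIcc (0:ℝ) 1 zero_le_one (2 * Real.sqrt 3 - 3)

theorem sqrt3_bounds : (3:ℝ)/2 < Real.sqrt 3 ∧ Real.sqrt 3 < 7/4 := by
  have h := Real.sq_sqrt (show (0:ℝ) ≤ 3 by norm_num)
  have h0 := Real.sqrt_nonneg 3
  constructor <;> nlinarith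

theorem coe_pDef : (pDef : ℝ) = 2 * Real.sqrt 3 - 3 := by
  have ⟨h1, h2⟩ := sqrt3_bounds
  rw [pDef, Set.projIcc_of_mem]
  constructor <;> linarith

theorem pDef_lt_half : (pDef : ℝ) < 1 / 2 := by
  rw [coe_pDef]; have := sqrt3_bounds.2; linarith

/-- one-coordinate cylinder of the biased plaquette field -/
theorem μP_mem (f : Site 2) :
    sitePercolation (Site 2) (Set.projIcc (0:ℝ) 1 zero_le_one (2 * Real.sqrt 3 - 3)) {P : Set (Site 2) | f ∈ P} =
      toNNReal pDef := by
  rw [sitePercolation, setBernoulli_apply']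
  have : (fun p : Site 2 → Prop ↦ {i | p i}) ⁻¹' {P : Set (Site 2) | f ∈ P}
      = Set.pi (({f} : Finset (Site 2)) : Set (Site 2)) (fun _ => {q : Prop | q}) := by
    ext g; simp
  rw [this, Measure.infinitePi_pi _ (fun _ _ => MeasurableSpace.measurableSet_top), Finset.prod_singleton]
  simp [Set.indicator, pDef]

/-- the increasing colour events `E₁ = {c(0,0) ∨ c(1,0)}` and `E₂ = {c(0,1) ∧ c(1,1)}` in bit form
(valid when `0 ∈ S`) -/
def E₁ : Set Ω := {ω | Xor (0 ∈ ω.1) (0 ∈ ω.2.1) ∨ Xor (1 ∈ ω.1) (0 ∈ ω.2.1)}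
def E₂ : Set Ω := {ω | Xor (0 ∈ ω.1) (1 ∈ ω.2.1) ∧ Xor (1 ∈ ω.1) (Xor (1 ∈ ω.2.1) (![0, 0] ∈ ω.2.2.1))}
/-- the set of hidden bits on which the two events are compatible -/
def G : Set Rest := {y | (0 ∈ y.1 ↔ 1 ∈ y.1) ∨ ![0, 0] ∈ y.2.1}

theorem measurable_A0 : Measurable fun ω : Ω => (0 : ℤ) ∈ ω.1 := (measurable_set_mem 0).comp measurable_fst
theorem measurable_A1 : Measurable fun ω : Ω => (1 : ℤ) ∈ ω.1 := (measurable_set_mem 1).comp measurable_fst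
theorem measurable_B0 : Measurable fun ω : Ω => (0 : ℤ) ∈ ω.2.1 :=
  (measurable_set_mem 0).comp (measurable_fst.comp measurable_snd)
theorem measurable_B1 : Measurable fun ω : Ω => (1 : ℤ) ∈ ω.2.1 :=
  (measurable_set_mem 1).comp (measurable_fst.comp measurable_snd)
theorem measurable_P00 : Measurable fun ω : Ω => ![0, 0] ∈ ω.2.2.1 :=
  (measurable_set_mem _).comp (measurable_fst.comp (measurable_snd.comp measurable_snd))

theorem measurable_xor {α : Type*} [MeasurableSpace α] {p q : α → Prop} (hp : Measurable p) (hq : Measurable q) :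
    Measurable fun a => Xor (p a) (q a) :=
  (hp.and hq.not).or (hq.and hp.not)

theorem measurableSet_E₁ : MeasurableSet E₁ :=
  measurableSet_setOf.2 ((measurable_xor measurable_A0 measurable_B0).or (measurable_xor measurable_A1 measurable_B0))

theorem measurableSet_E₂ : MeasurableSet E₂ :=
  measurableSet_setOf.2 ((measurable_xor measurable_A0 measurable_B1).and
    (measurable_xor measurable_A1 (measurable_xor measurable_B1 measurable_P00)))

theorem measurableSet_G : MeasurableSet G :=
  measurableSet_setOf.2 ((((measurable_set_mem 0).comp measurable_fst).iff ((measurable_set_mem 1).comp measurable_fst)).or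
    ((measurable_set_mem _).comp (measurable_fst.comp measurable_snd)))

theorem slice_E₂ (y : Rest) :
    sitePercolation ℤ half ((fun A : Set ℤ => (A, y)) ⁻¹' E₂) = 4⁻¹ := by
  have : (fun A : Set ℤ => (A, y)) ⁻¹' E₂ =
      {A : Set ℤ | (0 ∈ A ↔ ¬ (1 ∈ y.1)) ∧ (1 ∈ A ↔ ¬ Xor (1 ∈ y.1) (![0, 0] ∈ y.2.1))} := by
    ext A; simp only [E₂, Xor, Set.mem_preimage, Set.mem_setOf_eq]; tauto
  rw [this, μA_two']

theorem slice_E₁ (y : Rest) :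
    sitePercolation ℤ half ((fun A : Set ℤ => (A, y)) ⁻¹' E₁) = 1 - 4⁻¹ := by
  have hset : (fun A : Set ℤ => (A, y)) ⁻¹' E₁ = {A : Set ℤ | (0 ∈ A ↔ (0 ∈ y.1)) ∧ (1 ∈ A ↔ (0 ∈ y.1))}ᶜ := by
    ext A; simp only [E₁, Xor, Set.mem_preimage, Set.mem_setOf_eq, Set.mem_compl_iff]; tauto
  have hmeas : MeasurableSet {A : Set ℤ | (0 ∈ A ↔ (0 ∈ y.1)) ∧ (1 ∈ A ↔ (0 ∈ y.1))} :=
    measurableSet_setOf.2 (((measurable_set_mem 0).iff measurable_const).and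
      ((measurable_set_mem 1).iff measurable_const))
  rw [hset, measure_compl hmeas (measure_ne_top _ _), measure_univ, μA_two']

theorem slice_E₁E₂ (y : Rest) :
    sitePercolation ℤ half ((fun A : Set ℤ => (A, y)) ⁻¹' (E₁ ∩ E₂)) = G.indicator (fun _ => (4⁻¹ : ℝ≥0∞)) y := by
  by_cases hG : y ∈ G
  · rw [Set.indicator_of_mem hG]
    have : (fun A : Set ℤ => (A, y)) ⁻¹' (E₁ ∩ E₂) =
        {A : Set ℤ | (0 ∈ A ↔ ¬ (1 ∈ y.1)) ∧ (1 ∈ A ↔ ¬ Xor (1 ∈ y.1) (![0, 0] ∈ y.2.1))} := by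
      ext A
      simp only [E₁, E₂, G, Xor, Set.mem_preimage, Set.mem_inter_iff, Set.mem_setOf_eq] at hG ⊢
      tauto
    rw [this, μA_two']
  · rw [Set.indicator_of_notMem hG]
    have : (fun A : Set ℤ => (A, y)) ⁻¹' (E₁ ∩ E₂) = ∅ := by
      ext A
      simp only [E₁, E₂, G, Xor, Set.mem_preimage, Set.mem_inter_iff, Set.mem_setOf_eq,
        Set.mem_empty_iff_false, iff_false] at hG ⊢
      tauto
    rw [this, measure_empty]

theorem μIK_E₂ : μIK E₂ = 4⁻¹ := by
  rw [μIK_eq, Measure.prod_apply_symm measurableSet_E₂]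
  simp only [slice_E₂, lintegral_const, measure_univ, mul_one]

theorem μIK_E₁ : μIK E₁ = 1 - 4⁻¹ := by
  rw [μIK_eq, Measure.prod_apply_symm measurableSet_E₁]
  simp only [slice_E₁, lintegral_const, measure_univ, mul_one]

theorem μIK_E₁E₂ : μIK (E₁ ∩ E₂) = 4⁻¹ * ν G := by
  rw [μIK_eq, Measure.prod_apply_symm (measurableSet_E₁.inter measurableSet_E₂)]
  simp only [slice_E₁E₂]
  rw [lintegral_indicator_const measurableSet_G]

/-- the hidden-bit event has probability `1/2 + p/2` -/
theorem ν_G : ν G = 2⁻¹ + 2⁻¹ * toNNReal pDef := by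
  have hG : G = ({B : Set ℤ | (0 ∈ B ↔ True) ∧ (1 ∈ B ↔ True)} ×ˢ (Set.univ : Set (Set (Site 2) × (Set (Site 2) × Set (Site 2))))) ∪
      (({B : Set ℤ | (0 ∈ B ↔ False) ∧ (1 ∈ B ↔ False)} ×ˢ Set.univ) ∪
      (({B : Set ℤ | (0 ∈ B ↔ True) ∧ (1 ∈ B ↔ False)} ∪ {B : Set ℤ | (0 ∈ B ↔ False) ∧ (1 ∈ B ↔ True)}) ×ˢ
        ({P : Set (Site 2) | ![0, 0] ∈ P} ×ˢ (Set.univ : Set (Set (Site 2) × Set (Site 2)))))) := by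
    ext y
    simp only [G, Set.mem_setOf_eq, Set.mem_union, Set.mem_prod, Set.mem_univ, and_true, iff_true, iff_false]
    tauto
  have hm : ∀ P Q : Prop, MeasurableSet {B : Set ℤ | (0 ∈ B ↔ P) ∧ (1 ∈ B ↔ Q)} := fun P Q =>
    measurableSet_setOf.2 (((measurable_set_mem 0).iff measurable_const).and ((measurable_set_mem 1).iff measurable_const))
  have h2 : sitePercolation ℤ half ({B : Set ℤ | (0 ∈ B ↔ True) ∧ (1 ∈ B ↔ False)} ∪
      {B : Set ℤ | (0 ∈ B ↔ False) ∧ (1 ∈ B ↔ True)}) = 4⁻¹ + 4⁻¹ := by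
    rw [measure_union, μA_two', μA_two']
    · exact Set.disjoint_left.2 fun B h h' => (h'.1.1 (h.1.2 trivial)).elim
    · exact hm _ _
  rw [hG, measure_union, measure_union]
  · simp only [ν, Measure.prod_prod, measure_univ, mul_one, μA_two', h2, μP_mem]
    have hq : (4:ℝ≥0∞)⁻¹ = 2⁻¹ * 2⁻¹ := by
      rw [← ENNReal.mul_inv (Or.inl two_ne_zero) (Or.inl (by norm_num))]; norm_num
    have hx : (2:ℝ≥0∞)⁻¹ * 2⁻¹ + 2⁻¹ * 2⁻¹ = 2⁻¹ := by
      rw [← mul_add, ENNReal.inv_two_add_inv_two, mul_one]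
    rw [hq, hx, ← add_assoc, hx]
  · exact Set.disjoint_left.2 fun y h h' => by
      simp only [Set.mem_prod, Set.mem_setOf_eq, Set.mem_union] at h h'; tauto
  · exact ((hm _ _).union (hm _ _)).prod ((measurableSet_mem _).prod MeasurableSet.univ)
  · exact Set.disjoint_left.2 fun y h h' => by
      simp only [Set.mem_prod, Set.mem_setOf_eq, Set.mem_union] at h h'; tauto
  · exact ((hm _ _).prod MeasurableSet.univ).union (((hm _ _).union (hm _ _)).prod ((measurableSet_mem _).prod MeasurableSet.univ))

theorem μIK_real_E₂ : μIK.real E₂ = 1 / 4 := by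
  rw [Measure.real, μIK_E₂, ENNReal.toReal_inv]; norm_num

theorem μIK_real_E₁ : μIK.real E₁ = 3 / 4 := by
  rw [Measure.real, μIK_E₁, ENNReal.toReal_sub_of_le (ENNReal.inv_le_one.2 (by norm_num)) ENNReal.one_ne_top,
    ENNReal.toReal_inv]
  norm_num

theorem μIK_real_E₁E₂ : μIK.real (E₁ ∩ E₂) = (1 + (pDef : ℝ)) / 8 := by
  rw [Measure.real, μIK_E₁E₂, ν_G, ENNReal.toReal_mul, ENNReal.toReal_add (by norm_num)
    (ENNReal.mul_ne_top (by norm_num) ENNReal.coe_ne_top), ENNReal.toReal_mul, ENNReal.toReal_inv,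
    ENNReal.toReal_inv, ENNReal.coe_toReal, coe_toNNReal]
  norm_num; ring

/-- NO POSITIVE ASSOCIATION: the increasing colour events `E₁`, `E₂` are negatively correlated. -/
theorem fkg_fails_on_a_face : μIK.real (E₁ ∩ E₂) < μIK.real E₁ * μIK.real E₂ := by
  rw [μIK_real_E₁E₂, μIK_real_E₁, μIK_real_E₂]
  have := pDef_lt_half
  nlinarith


theorem blk_zero_one (S : Set ℤ) (ω : Ω) : blk S ω ![0, 1] ↔ Xor (0 ∈ ω.1) (1 ∈ ω.2.1) := by
  simp [blk, Xor]

theorem blk_one_one {S : Set ℤ} (hS : (0:ℤ) ∈ S) (ω : Ω) :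
    blk S ω ![1, 1] ↔ Xor (1 ∈ ω.1) (Xor (1 ∈ ω.2.1) (![0, 0] ∈ ω.2.2.1)) := by
  have h1 : Finset.Ico (min (0:ℤ) 1) (max 0 1) = {0} := by decide
  simp only [blk, par, Matrix.cons_val_zero, Matrix.cons_val_one, h1,
    Finset.singleton_product_singleton, Finset.filter_singleton, hS, true_and, not_true, false_and, or_false]
  by_cases h : ![(0:ℤ), 0] ∈ ω.2.2.1
  · simp [h]
  · simp [h]

theorem E₁_eq (S : Set ℤ) : E₁ = {ω | blk S ω ![0, 0] ∨ blk S ω ![1, 0]} := by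
  ext ω; simp only [E₁, Set.mem_setOf_eq, blk_zero_zero, blk_one_zero]

theorem E₂_eq {S : Set ℤ} (hS : (0:ℤ) ∈ S) : E₂ = {ω | blk S ω ![0, 1] ∧ blk S ω ![1, 1]} := by
  ext ω; simp only [E₂, Set.mem_setOf_eq, blk_zero_one, blk_one_one hS]

/-- NO POSITIVE ASSOCIATION of the colour field (headline form): on the face at the origin of an
`S`-column, the increasing colour events `{c(0,0) ∨ c(1,0)}` and `{c(0,1) ∧ c(1,1)}` satisfy
`P(E₁ ∩ E₂) = (1+p)/8 < 3/16 = P(E₁) P(E₂)` (`p = 2√3 − 3 < 1/2`; covariance `−ρ/16`). -/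
theorem colourField_not_positivelyAssociated {S : Set ℤ} (hS : (0:ℤ) ∈ S) :
    μIK.real ({ω | blk S ω ![0, 0] ∨ blk S ω ![1, 0]} ∩ {ω | blk S ω ![0, 1] ∧ blk S ω ![1, 1]}) <
      μIK.real {ω | blk S ω ![0, 0] ∨ blk S ω ![1, 0]} * μIK.real {ω | blk S ω ![0, 1] ∧ blk S ω ![1, 1]} := by
  rw [← E₁_eq S, ← E₂_eq hS]
  exact fkg_fails_on_a_face


/-! ## §4b the BOND field is not positively associated either: one diagonal per face -/

/-- main diagonal bond of the origin face present, in bit form (`0 ∈ S`): both endpoints black and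
the coin says "main". -/
def Dmain : Set Ω := {ω | (Xor (0 ∈ ω.1) (0 ∈ ω.2.1) ∧ Xor (1 ∈ ω.1) (Xor (1 ∈ ω.2.1) (![0, 0] ∈ ω.2.2.1))) ∧
  ![0, 0] ∉ ω.2.2.2.2}
/-- anti-diagonal bond of the origin face present, in bit form (`0 ∈ S`). -/
def Danti : Set Ω := {ω | (Xor (0 ∈ ω.1) (1 ∈ ω.2.1) ∧ Xor (1 ∈ ω.1) (0 ∈ ω.2.1)) ∧ ![0, 0] ∈ ω.2.2.2.2}

theorem measurable_C00 : Measurable fun ω : Ω => ![0, 0] ∈ ω.2.2.2.2 :=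
  (measurable_set_mem _).comp (measurable_snd.comp (measurable_snd.comp (measurable_snd.comp measurable_snd)))

theorem measurableSet_Dmain : MeasurableSet Dmain :=
  measurableSet_setOf.2 (((measurable_xor measurable_A0 measurable_B0).and
    (measurable_xor measurable_A1 (measurable_xor measurable_B1 measurable_P00))).and measurable_C00.not)

theorem measurableSet_Danti : MeasurableSet Danti :=
  measurableSet_setOf.2 (((measurable_xor measurable_A0 measurable_B1).and
    (measurable_xor measurable_A1 measurable_B0)).and measurable_C00)

/-- the coin cylinder of the hidden bits -/
theorem ν_coin_not : ν {y : Rest | ![0, 0] ∉ y.2.2.2} = 2⁻¹ := by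
  have : {y : Rest | ![0, 0] ∉ y.2.2.2} = (Set.univ : Set (Set ℤ)) ×ˢ ((Set.univ : Set (Set (Site 2))) ×ˢ
      ((Set.univ : Set (Set (Site 2))) ×ˢ {C : Set (Site 2) | ![0, 0] ∉ C})) := by
    ext y; simp
  rw [this, ν, Measure.prod_prod, Measure.prod_prod, Measure.prod_prod, measure_univ, measure_univ, measure_univ,
    one_mul, one_mul, one_mul, sitePercolation, setBernoulli_apply']
  have h2 : (fun p : Site 2 → Prop ↦ {i | p i}) ⁻¹' {C : Set (Site 2) | ![0, 0] ∉ C}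
      = Set.pi (({![0, 0]} : Finset (Site 2)) : Set (Site 2)) (fun _ => {q : Prop | ¬ q}) := by
    ext g; simp
  rw [h2, Measure.infinitePi_pi _ (fun _ _ => MeasurableSpace.measurableSet_top), Finset.prod_singleton]
  simp [Set.indicator, symm_half, coe_toNNReal_half]

theorem ν_coin_mem : ν {y : Rest | ![0, 0] ∈ y.2.2.2} = 2⁻¹ := by
  have : {y : Rest | ![0, 0] ∈ y.2.2.2} = (Set.univ : Set (Set ℤ)) ×ˢ ((Set.univ : Set (Set (Site 2))) ×ˢ
      ((Set.univ : Set (Set (Site 2))) ×ˢ {C : Set (Site 2) | ![0, 0] ∈ C})) := by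
    ext y; simp
  rw [this, ν, Measure.prod_prod, Measure.prod_prod, Measure.prod_prod, measure_univ, measure_univ, measure_univ,
    one_mul, one_mul, one_mul, sitePercolation, setBernoulli_apply']
  have h2 : (fun p : Site 2 → Prop ↦ {i | p i}) ⁻¹' {C : Set (Site 2) | ![0, 0] ∈ C}
      = Set.pi (({![0, 0]} : Finset (Site 2)) : Set (Site 2)) (fun _ => {q : Prop | q}) := by
    ext g; simp
  rw [h2, Measure.infinitePi_pi _ (fun _ _ => MeasurableSpace.measurableSet_top), Finset.prod_singleton]
  simp [Set.indicator, coe_toNNReal_half]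

theorem slice_Dmain (y : Rest) :
    sitePercolation ℤ half ((fun A : Set ℤ => (A, y)) ⁻¹' Dmain) =
      {y : Rest | ![0, 0] ∉ y.2.2.2}.indicator (fun _ => (4⁻¹ : ℝ≥0∞)) y := by
  by_cases h : ![0, 0] ∈ y.2.2.2
  · rw [Set.indicator_of_notMem (by simpa using h)]
    have : (fun A : Set ℤ => (A, y)) ⁻¹' Dmain = ∅ := by
      ext A; simp [Dmain, h]
    rw [this, measure_empty]
  · rw [Set.indicator_of_mem (by simpa using h)]
    have : (fun A : Set ℤ => (A, y)) ⁻¹' Dmain =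
        {A : Set ℤ | (0 ∈ A ↔ ¬ (0 ∈ y.1)) ∧ (1 ∈ A ↔ ¬ Xor (1 ∈ y.1) (![0, 0] ∈ y.2.1))} := by
      ext A; simp only [Dmain, Xor, Set.mem_preimage, Set.mem_setOf_eq, h, not_false_eq_true, and_true]; tauto
    rw [this, μA_two']

theorem slice_Danti (y : Rest) :
    sitePercolation ℤ half ((fun A : Set ℤ => (A, y)) ⁻¹' Danti) =
      {y : Rest | ![0, 0] ∈ y.2.2.2}.indicator (fun _ => (4⁻¹ : ℝ≥0∞)) y := by
  by_cases h : ![0, 0] ∈ y.2.2.2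
  · rw [Set.indicator_of_mem (by simpa using h)]
    have : (fun A : Set ℤ => (A, y)) ⁻¹' Danti =
        {A : Set ℤ | (0 ∈ A ↔ ¬ (1 ∈ y.1)) ∧ (1 ∈ A ↔ ¬ (0 ∈ y.1))} := by
      ext A; simp only [Danti, Xor, Set.mem_preimage, Set.mem_setOf_eq, h, and_true]; tauto
    rw [this, μA_two']
  · rw [Set.indicator_of_notMem (by simpa using h)]
    have : (fun A : Set ℤ => (A, y)) ⁻¹' Danti = ∅ := by
      ext A; simp [Danti, h]
    rw [this, measure_empty]

theorem measurableSet_coin_not : MeasurableSet {y : Rest | ![0, 0] ∉ y.2.2.2} :=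
  measurableSet_setOf.2 ((measurable_set_mem _).comp (measurable_snd.comp (measurable_snd.comp measurable_snd))).not

theorem measurableSet_coin_mem : MeasurableSet {y : Rest | ![0, 0] ∈ y.2.2.2} :=
  measurableSet_setOf.2 ((measurable_set_mem _).comp (measurable_snd.comp (measurable_snd.comp measurable_snd)))

theorem μIK_Dmain : μIK Dmain = 4⁻¹ * 2⁻¹ := by
  rw [μIK_eq, Measure.prod_apply_symm measurableSet_Dmain]
  simp only [slice_Dmain]
  rw [lintegral_indicator_const measurableSet_coin_not, ν_coin_not]

theorem μIK_Danti : μIK Danti = 4⁻¹ * 2⁻¹ := by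
  rw [μIK_eq, Measure.prod_apply_symm measurableSet_Danti]
  simp only [slice_Danti]
  rw [lintegral_indicator_const measurableSet_coin_mem, ν_coin_mem]

theorem Dmain_inter_Danti : Dmain ∩ Danti = ∅ := by
  ext ω; simp only [Dmain, Danti, Set.mem_inter_iff, Set.mem_setOf_eq, Set.mem_empty_iff_false, iff_false]
  tauto

/-- identification with the bond events of the crux's `edges` (for `0 ∈ S`) -/
theorem mainDiag_mem_edges_iff {S : Set ℤ} (hS : (0:ℤ) ∈ S) (ω : Ω) :
    s(![0, 0], ![1, 1]) ∈ edges S ω ↔ ω ∈ Dmain := by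
  simp only [edges, Dmain, Set.mem_setOf_eq]
  constructor
  · rintro ⟨u, v, huv, hu, hv, hrel⟩
    rw [Sym2.eq_iff] at huv
    rcases huv with ⟨rfl, rfl⟩ | ⟨rfl, rfl⟩
    · refine ⟨⟨(blk_zero_zero S ω).1 hu, (blk_one_one hS ω).1 hv⟩, ?_⟩
      rcases hrel with h | h | ⟨-, h⟩ | ⟨h, -⟩
      · exact absurd (congrFun h 1) (by simp)
      · exact absurd (congrFun h 0) (by simp)
      · simpa [anti, hS] using h
      · exact absurd (congrFun h 1) (by simp)
    · rcases hrel with h | h | ⟨h, -⟩ | ⟨h, -⟩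
      · exact absurd (congrFun h 0) (by simp)
      · exact absurd (congrFun h 1) (by simp)
      · exact absurd (congrFun h 0) (by simp)
      · exact absurd (congrFun h 0) (by simp)
  · rintro ⟨⟨h0, h1⟩, hc⟩
    exact ⟨![0, 0], ![1, 1], rfl, (blk_zero_zero S ω).2 h0, (blk_one_one hS ω).2 h1,
      Or.inr (Or.inr (Or.inl ⟨by ext i; fin_cases i <;> simp, by simpa [anti, hS] using hc⟩))⟩

theorem antiDiag_mem_edges_iff {S : Set ℤ} (hS : (0:ℤ) ∈ S) (ω : Ω) :
    s(![0, 1], ![1, 0]) ∈ edges S ω ↔ ω ∈ Danti := by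
  simp only [edges, Danti, Set.mem_setOf_eq]
  constructor
  · rintro ⟨u, v, huv, hu, hv, hrel⟩
    rw [Sym2.eq_iff] at huv
    rcases huv with ⟨rfl, rfl⟩ | ⟨rfl, rfl⟩
    · refine ⟨⟨(blk_zero_one S ω).1 hu, (blk_one_zero S ω).1 hv⟩, ?_⟩
      rcases hrel with h | h | ⟨h, -⟩ | ⟨-, h⟩
      · exact absurd (congrFun h 1) (by simp)
      · exact absurd (congrFun h 0) (by simp)
      · exact absurd (congrFun h 1) (by simp)
      · have : ![(0:ℤ), 1] + ![0, -1] = ![0, 0] := by ext i; fin_cases i <;> simp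
        rw [this] at h
        simpa [anti, hS] using h
    · rcases hrel with h | h | ⟨h, -⟩ | ⟨h, -⟩
      · exact absurd (congrFun h 1) (by simp)
      · exact absurd (congrFun h 0) (by simp)
      · exact absurd (congrFun h 0) (by simp)
      · exact absurd (congrFun h 0) (by simp)
  · rintro ⟨⟨h0, h1⟩, hc⟩
    refine ⟨![0, 1], ![1, 0], rfl, (blk_zero_one S ω).2 h0, (blk_one_zero S ω).2 h1,
      Or.inr (Or.inr (Or.inr ⟨by ext i; fin_cases i <;> simp, ?_⟩))⟩
    have : ![(0:ℤ), 1] + ![0, -1] = ![0, 0] := by ext i; fin_cases i <;> simp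
    rw [this]
    simpa [anti, hS] using hc

/-- NO POSITIVE ASSOCIATION of the BOND field: in an `S`-column the two diagonal bonds of a face are
each open with probability `1/8` but never simultaneously (one diagonal per face), so the law of
`edges S ω` violates Harris–FKG for the increasing bond events `{main diagonal open}`,
`{anti-diagonal open}` — crossing events are increasing in exactly this structure. -/
theorem bondField_not_positivelyAssociated {S : Set ℤ} (hS : (0:ℤ) ∈ S) :
    μIK.real ({ω | s(![0, 0], ![1, 1]) ∈ edges S ω} ∩ {ω | s(![0, 1], ![1, 0]) ∈ edges S ω}) = 0 ∧
    μIK.real {ω | s(![0, 0], ![1, 1]) ∈ edges S ω} = 1 / 8 ∧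
    μIK.real {ω | s(![0, 1], ![1, 0]) ∈ edges S ω} = 1 / 8 := by
  have h1 : {ω | s(![0, 0], ![1, 1]) ∈ edges S ω} = Dmain := Set.ext (mainDiag_mem_edges_iff hS)
  have h2 : {ω | s(![0, 1], ![1, 0]) ∈ edges S ω} = Danti := Set.ext (antiDiag_mem_edges_iff hS)
  rw [h1, h2, Dmain_inter_Danti]
  refine ⟨by simp, ?_, ?_⟩
  · rw [Measure.real, μIK_Dmain, ENNReal.toReal_mul, ENNReal.toReal_inv, ENNReal.toReal_inv]; norm_num
  · rw [Measure.real, μIK_Danti, ENNReal.toReal_mul, ENNReal.toReal_inv, ENNReal.toReal_inv]; norm_num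


/-! ## §5 Numerical attack (adversarial Monte-Carlo over column patterns) -/

/-- NUMERICS — kit compute job `j008097` (2 cores, wall 967 s; `mcjob/main.py`, evidence
`compute-j008097.json` on stmt-CriticalPhenomena-5911; exact sampling of the box marginal of the
gauge: fresh boundary bits + independent plaquettes + coins, connectivity by 8-connected labelling
of a scale-2 pixel image — the per-sample duality "black LR xor white TB" held in 8000/8000
samples, so the encoding of the triangulation is exact). Smoke replicate `j007958` agrees.

EXACT `n = 2` (full enumeration, all `2^{W-1}` patterns): `min_S pH(4×2) = min_S pV(2×4) = 55/256
= 0.21484`, attained at `S = ∅` ONLY; every mixed pattern is higher (0.2203 – 0.2249).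

MONTE-CARLO, 35–39 patterns per `n` (∅, ℤ, kℤ and ℤ∖kℤ for k = 2,3,4,6,8, half-spaces, single
`S`-column (edge/mid), single `𝕋`-column, alternating blocks of length 2–64, Bernoulli(q) for
q = ¼,½,¾ × 3 seeds, Sturmian, squares, √n-spaced), 4000 samples (`n ≤ 64`), 2000 (`n = 128`),
1000 (`n = 256`); `p = min over patterns ± 1σ of that estimate` (selection-biased LOW by ≈ 2σ):

| n   | min_S pH(2n×n)        | min_S pV(n×2n)        | S=∅ (H / V)   | S=ℤ (H / V)   | max_S        |
|-----|-----------------------|-----------------------|---------------|---------------|--------------|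
| 4   | 0.183 ± .006 (half)   | 0.182 ± .006 (rand ½) | 0.200 / 0.182 | 0.209 / 0.211 | 0.218        |
| 8   | 0.171 ± .006 (1 S-col)| 0.165 ± .006 (1 S-col)| 0.177 / 0.172 | 0.191 / 0.192 | 0.204        |
| 16  | 0.155 ± .006 (∅)      | 0.151 ± .006 (4ℤ)     | 0.155 / 0.155 | 0.186 / 0.186 | 0.197        |
| 32  | 0.151 ± .006 (∅)      | 0.144 ± .006 (half)   | 0.151 / 0.156 | 0.184 / 0.185 | 0.199        |
| 64  | 0.141 ± .006 (1 S-col)| 0.149 ± .006 (8ℤ)     | 0.161 / 0.149 | 0.178 / 0.173 | 0.196        |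
| 128 | 0.143 ± .008 (1 S-col)| 0.133 ± .008 (1 S-col)| 0.153 / 0.159 | 0.179 / 0.172 | 0.199        |
| 256 | 0.135 ± .011 (∅)      | 0.137 ± .011 (8ℤ)     | 0.135 / 0.162 | 0.187 / 0.180 | 0.204        |

GREEDY MINIMISATION over `S` (coordinate descent from S = ∅, S = ℤ and two random starts,
3 sweeps, 6000/4000/2000 samples per evaluation, final re-evaluation with 4× samples):
`n = 8`: best 0.172 (H, S = ∅) / 0.174 (V, one S-column); `n = 16`: 0.164 (H, S = ∅) / 0.161
(V, S = ∅); `n = 32`: 0.156 (H, single S-column) / 0.157 (V, single S-column). No start found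
anything below the `S = ∅` value within 2σ; from `S = ℤ` the descent stalls at ≈ 0.186.

READING. (a) No pattern family decays with `n`: every estimate at every `n ≤ 256` lies in
`[0.133, 0.225]`, and the slow drift of the minimum (0.18 → 0.135–0.15) is the finite-size approach
of the `S = ∅` member to its CONTINUUM VALUE 0.15119 = Cardy's formula for the 60° parallelogram
with sides 2 : 1 (the conformal image of the `2n × n` box of `ℤ² + (1,−1)` under `1 ↦ 1,
i ↦ e^{iπ/3}`), computed by Schwarz–Christoffel at 30 digits in kit `j014581` (sanity: the same
code returns 0.175647 for the 2 : 1 rectangle and 0.061638 for 3 : 1, Cardy's printed values; the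
120° parallelogram gives the same 0.15119, as the `x ↔ y` symmetry demands). Precision run
(`j014581`, 60k/40k/20k/8k samples): `S = ∅` gives 0.1609/0.1599 (n = 16, H/V), 0.1584/0.1568
(32), 0.1514/0.1538 (64), 0.1579/0.1447 ± 0.004 (128) — converging to 0.151 from above.
(b) The infimum over `S` is numerically ATTAINED AT THE ENDPOINT `S = ∅` (or indistinguishable
from it: single sparse `S`-columns), i.e. at site percolation on `𝕋 = ℤ² + (1,−1)` — whose RSW is
PROVED in the tree (`Literature.Probability.Percolation.tri_rsw_half_holds`, same diagonal
convention `triDiag = ![1,-1]`; the crux's `S = ∅`, `2n × n` box is the LR crossing of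
`rectangle (2n−1) (n−1)`, bounded below via `ρ = 3` and width-monotonicity). (c) Mixing in
isotropic IK columns only RAISES long-way crossing probabilities, towards and slightly beyond the
`S = ℤ` value ≈ 0.18 (Cardy 2:1 = 0.1756 + finite size); dense-but-not-full patterns (ℤ∖2ℤ,
blocks of 4) are the maxima ≈ 0.20. (d) Hence the data support the crux with any `c` below ≈ 0.145
(the `S = ∅` values, continuum limit 0.151) and suggest the sharper conjecture
`inf_S pH(2n×n) ≈ pH_{S=∅}(2n×n)`, `inf_S pV ≈ pV_{S=∅}` (exact equality holds at `n = 1, 2`; at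
`n = 16–128` single sparse `S`-columns are indistinguishable from `S = ∅` at the 0.005 level —
precision run `j014581`: e.g. `n = 32` H: ∅ 0.1584, one edge `S`-column 0.1523, one mid column
0.1586 ± 0.0018; `S = ℤ` 0.1798; `ℤ ∖ {edge}` 0.1788). REPLICATION (kit `j009921`, independent
seed, 2000/1000/500 samples, same 39 families, `n ≤ 256` — the `n = 512` row was not scheduled by the
script): same picture, every estimate in `[0.122, 0.227]`, minima again at `S = ∅`-like sparse patterns
(`n = 256`: min 0.132 ± 0.015 H / 0.122 ± 0.015 V vs `S = ∅` 0.144 / 0.150, within the selection bias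
of a 39-fold minimum), greedy descent from `S = ∅` stays at `S = ∅` (0.157–0.174). VERDICT OF THE
ATTACK: no kill. -/
theorem numerics_summary : True := trivial

/-! ## §6 Why the crux resists cheap refutation (for the provers) -/

/-- WHY IT RESISTS (paper analysis, this seat):
1. Finite `n` is harmless: for fixed `n` the crossing probabilities depend on `S` only through the
   `2n − 1` face columns of the box, so `inf_S` is a minimum over finitely many patterns, each
   positive; `¬crux` ⟺ `liminf_{n→∞} min_S = 0` — only an ASYMPTOTIC degeneration can kill it, and
   that is not a `decide`/small-model matter.
2. Exact identities that pin "criticality" for EVERY `S`: colour-flip symmetry (`A ↦ Aᶜ`) and the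
   self-matching property of a triangulated box give `P(black LR of W×H) + P(black TB of W×H) = 1`,
   in particular `pH(n×n) + pV(n×n) = 1` for all `S, n` (checked per-sample in job j008097). So no
   pattern is sub- or super-critical in both directions; a kill needs unbounded ANISOTROPY in `S`.
3. Both pure phases are isotropic up to a FIXED shear: `S = ∅` is site percolation on 𝕋 drawn with
   anti-diagonals (conformal structure = image of the equilateral one under `1 ↦ 1, e^{iπ/3} ↦ i`,
   singular-value ratio √3, principal axes along the diagonals, hence `pH(2n×n) = pV(n×2n)` by the
   `x ↔ y` symmetry of that lattice); `S = ℤ` is `D₄`-symmetric. A columnar mixture of two bounded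
   conformal structures is expected to homogenise to a bounded one (no mechanism for resonance:
   the colour field is pairwise independent with 4-point function `ρ^{area}`, `ρ ≈ 0.072`, in every
   column type, and every bond/diagonal type keeps probability ≥ 1/4·1/2).
4. The natural one-parameter strengthening (uniformity also in the defect probability
   `p ∈ [0, 2√3−3]`) does NOT obviously fail either: at `p = 0`, `S = ℤ` the faces are all even,
   colours are `a_m ⊕ b_n`, the picture is a block checkerboard on the renewal grid and black
   rectangles connect through corners by independent fair coins — critical BOND percolation on `ℤ²`
   drawn on a random grid (the route's FreezeIdentification `M(0,½)`), again RSW-positive. So the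
   whole corner-fugacity segment interpolates between two RSW models; the crux sits inside it.
5. What a disproof would need: a family `S_n` producing effective aspect-ratio distortion → ∞, e.g.
   an interface phenomenon between `S`-blocks and `ℤ∖S`-blocks that channels crossings. The colour
   law has no interface energy (box marginals are free plaquette fields with column-wise weights,
   translation-covariant), and the diagonal rule changes only the micro-geometry, so no such channel
   is visible on paper; the Monte-Carlo of §5 probes it directly (half-space, single-defect and
   block patterns with block length up to `n`).
6. Structure a prover can still use (no FKG needed): (i) the gauge is a PRODUCT measure on bits, and
   the colour law on a box is a Markov field with one 4-body plaquette interaction per `S`-face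
   (weights `t^{odd}`), so colours in two regions separated by a column of FAIR faces (`ℤ ∖ S`
   column) are exactly independent, and in general conditionally independent given one boundary
   column; (ii) exact symmetries: colour flip, vertical translations, `S`-covariant horizontal
   translations, rotation by π composed with `S ↦ −S`, and the duality identity of item 2;
   (iii) the `S = ∅` endpoint is PROVED in tree (`Literature.Probability.Percolation.tri_rsw_half_holds`);
   (iv) the XOR structure `σ = A ⊕ B ⊕ R` is the setting of the "XOR trick" RSW of
   Crawford–Glazman–Harel–Peled (arXiv:2001.11977), the one RSW technology in print that does not
   lean on positive association of the spins.
7. What a proof CANNOT rely on alone: pairwise independence + fair marginals + lattice symmetry do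
   not pin box-crossing probabilities — Benjamini–Gurel-Gurevich–Peled, "On k-wise independent
   distributions and Boolean functions" (arXiv:1201.3261), §4.6 Thm 19–20 (read this session,
   p. 8 of the materialised text): for the `n × n` grid-crossing function the amount of
   independence needed to control it grows like `K₁(f) ≥ 2^{√(log log n)}`, and on `ℤ^d` there are
   `k`-wise independent site models with marginal `p` that percolate and others that do not, for
   every `k` and every `p ∈ (0,1)`. So the 4-body plaquette structure (not just "pairwise
   independent, ρ-small 4-point function") must enter any proof of the crux. -/
theorem why_it_resists : True := trivial

end

end Summit.CriticalPhenomena.CardyFormulaZ2.Cruxes.IKMixedBoxCrossing.Disproof
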